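import Mathlib
import Summits.ValiantsHypothesis.ValiantsHypothesis.Theorems.LacunarySymmetroidMatrixDescartesCensusWindowFourPocketBranch

/-!
# `MatrixDescartes` census — WINDOW-4 POCKET ROWS, calculus layer: quasi-concavity of `L1 − s·L2` / `L2 − s·L1`, product ⇒ log facts

HONEST FRAMING.  Object-search cell `pub-symmetroid`, door-A target `DoorA26 := PosRootLawAt 2 6 19`
(stmt-ValiantsHypothesis-19979; OPEN, typed, never asserted).  Necessary-condition rows about the four-term WINDOWS of HYPOTHETICAL
Descartes-sharp fewnomials; nothing here bounds any census count, kills any cell or bears on `MatrixDescartes`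
(stmt-ValiantsHypothesis-18050) / `VP ≠ VNP`.

Pure real analysis (Mathlib + `…CensusWindowFourPocketBranch` only), landed ahead of the row files it serves.  With
`A(t) = (u+v)+w·t`, `B(t) = u+(v+w)·t`, `L1(t) = (u+v) log A − u log B` (`= log H1 + v log v`), `L2(t) = (v+w) log B − w log A − v log t`
(`= log H2 + v log v`):

* `hasDerivAt_pocket_k`, `pocket_k_lower_ge_min` — for a slope `s`, `k := L1 − s·L2` has
  `k′(t) = v·(w(v+w)t − u(u+v))·(t − s)/(t·A·B)`, so on the lower branch `t ≤ t* = u(u+v)/(w(v+w))` it increases while `t ≤ s` and decreases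
  while `t ≥ s`: `k(t) ≥ min (k p) (k q)` for `0 < p ≤ t ≤ q ≤ t*` (QUASI-CONCAVITY — the kernel form of «the pocket boundary is concave in
  slack coordinates», `dσ1/dσ2 = t` along the branch);
* `hasDerivAt_pocket_m`, `pocket_m_upper_ge_min` — the mirror `m := L2 − s·L1` on the upper branch (`s ≥ 0`);
* `log_pow_mul_pow_mul_pow`, `pocket_logH1_le_of_prod`, `pocket_le_logH1_of_prod`, `pocket_logH2_le_of_prod`, `pocket_le_logH2_of_prod` —
  closed product inequalities about the branch constants (`H1(t) ≤ M`, `F ≤ H1(t)`, `H2(t) ≤ M`, `F ≤ H2(t)`, checkable by `norm_num` for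
  rational `t, M, F`) turned into the log facts the rows consume.

[folklore] One-variable calculus; elementary.
-/

-- `Summit.ValiantsHypothesis.ValiantsHypothesis.…` repeats a component by the D-0017 layout
-- (single-conjunct summit), which the `dupNamespace` linter flags; the name is mandated.
set_option linter.dupNamespace false

namespace Summit.ValiantsHypothesis.ValiantsHypothesis.Theorems.LacunarySymmetroidMatrixDescartes.Census

open Polynomial Finset Set
open scoped BigOperators Polynomial

/-- Derivative of `k = L1 − s·L2` at `t > 0`: `v·(w(v+w)t − u(u+v))·(t − s)/(t·((u+v)+wt)·(u+(v+w)t))`. [folklore] -/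
theorem hasDerivAt_pocket_k {u v w : ℕ} (hu : 0 < u) (s : ℝ) {t : ℝ} (ht : 0 < t) :
    HasDerivAt (fun t : ℝ => (((u : ℝ) + v) * Real.log (((u : ℝ) + v) + (w : ℝ) * t)
        - (u : ℝ) * Real.log ((u : ℝ) + ((v : ℝ) + w) * t))
        - s * (((v : ℝ) + w) * Real.log ((u : ℝ) + ((v : ℝ) + w) * t)
          - (w : ℝ) * Real.log (((u : ℝ) + v) + (w : ℝ) * t) - (v : ℝ) * Real.log t))
      ((v : ℝ) * ((w : ℝ) * ((v : ℝ) + w) * t - (u : ℝ) * ((u : ℝ) + v)) * (t - s)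
        / (t * (((u : ℝ) + v) + (w : ℝ) * t) * ((u : ℝ) + ((v : ℝ) + w) * t))) t := by
  have hA : 0 < ((u : ℝ) + v) + (w : ℝ) * t := by positivity
  have hB : 0 < (u : ℝ) + ((v : ℝ) + w) * t := by positivity
  have hd1 : HasDerivAt (fun t : ℝ => ((u : ℝ) + v) * Real.log (((u : ℝ) + v) + (w : ℝ) * t)
      - (u : ℝ) * Real.log ((u : ℝ) + ((v : ℝ) + w) * t))
      (((u : ℝ) + v) * ((w : ℝ) / (((u : ℝ) + v) + (w : ℝ) * t))
        - (u : ℝ) * ((((v : ℝ) + w)) / ((u : ℝ) + ((v : ℝ) + w) * t))) t :=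
    ((hasDerivAt_log_affine hA).const_mul _).sub ((hasDerivAt_log_affine hB).const_mul _)
  have hd2 : HasDerivAt (fun t : ℝ => ((v : ℝ) + w) * Real.log ((u : ℝ) + ((v : ℝ) + w) * t)
      - (w : ℝ) * Real.log (((u : ℝ) + v) + (w : ℝ) * t) - (v : ℝ) * Real.log t)
      (((v : ℝ) + w) * ((((v : ℝ) + w)) / ((u : ℝ) + ((v : ℝ) + w) * t))
        - (w : ℝ) * ((w : ℝ) / (((u : ℝ) + v) + (w : ℝ) * t)) - (v : ℝ) * t⁻¹) t :=
    (((hasDerivAt_log_affine hB).const_mul _).sub ((hasDerivAt_log_affine hA).const_mul _)).sub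
      ((Real.hasDerivAt_log ht.ne').const_mul _)
  have hd := hd1.sub (hd2.const_mul s)
  refine hd.congr_deriv ?_
  have hA' := hA.ne'; have hB' := hB.ne'; have ht' := ht.ne'
  have e1 : ((u : ℝ) + v) * ((w : ℝ) / (((u : ℝ) + v) + (w : ℝ) * t))
        - (u : ℝ) * ((((v : ℝ) + w)) / ((u : ℝ) + ((v : ℝ) + w) * t))
      = (v : ℝ) * ((w : ℝ) * ((v : ℝ) + w) * t - (u : ℝ) * ((u : ℝ) + v))
        / ((((u : ℝ) + v) + (w : ℝ) * t) * ((u : ℝ) + ((v : ℝ) + w) * t)) := by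
    rw [mul_div_assoc', mul_div_assoc', div_sub_div _ _ hA' hB']
    congr 1; ring
  have e2 : ((v : ℝ) + w) * ((((v : ℝ) + w)) / ((u : ℝ) + ((v : ℝ) + w) * t))
        - (w : ℝ) * ((w : ℝ) / (((u : ℝ) + v) + (w : ℝ) * t)) - (v : ℝ) * t⁻¹
      = (v : ℝ) * ((w : ℝ) * ((v : ℝ) + w) * t - (u : ℝ) * ((u : ℝ) + v))
        / (t * (((u : ℝ) + v) + (w : ℝ) * t) * ((u : ℝ) + ((v : ℝ) + w) * t)) := by
    field_simp
    ring
  rw [e1, e2, mul_div_assoc', div_sub_div _ _ (by positivity) (by positivity), div_eq_div_iff (by positivity) (by positivity)]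
  ring

/-- **`k = L1 − s·L2` is quasi-concave on the lower branch**: for `0 ≤ s` and `0 < p ≤ t ≤ q ≤ t*`, `k(t) ≥ min (k p) (k q)`
(`k` increases while `t ≤ s` and decreases while `t ≥ s`, because `k′(t) = v·(w(v+w)t − u(u+v))·(t − s)/(positive)` and the first
factor is `≤ 0` on the lower branch). [folklore] -/
theorem pocket_k_lower_ge_min {u v w : ℕ} (hu : 0 < u) (hv : 0 < v) (hw : 0 < w) {s p q t : ℝ}
    (hp : 0 < p) (hpt : p ≤ t) (htq : t ≤ q) (hq : (w : ℝ) * ((v : ℝ) + w) * q ≤ (u : ℝ) * ((u : ℝ) + v)) :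
    min ((((u : ℝ) + v) * Real.log (((u : ℝ) + v) + (w : ℝ) * p) - (u : ℝ) * Real.log ((u : ℝ) + ((v : ℝ) + w) * p))
          - s * (((v : ℝ) + w) * Real.log ((u : ℝ) + ((v : ℝ) + w) * p)
            - (w : ℝ) * Real.log (((u : ℝ) + v) + (w : ℝ) * p) - (v : ℝ) * Real.log p))
        ((((u : ℝ) + v) * Real.log (((u : ℝ) + v) + (w : ℝ) * q) - (u : ℝ) * Real.log ((u : ℝ) + ((v : ℝ) + w) * q))
          - s * (((v : ℝ) + w) * Real.log ((u : ℝ) + ((v : ℝ) + w) * q)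
            - (w : ℝ) * Real.log (((u : ℝ) + v) + (w : ℝ) * q) - (v : ℝ) * Real.log q))
      ≤ (((u : ℝ) + v) * Real.log (((u : ℝ) + v) + (w : ℝ) * t) - (u : ℝ) * Real.log ((u : ℝ) + ((v : ℝ) + w) * t))
          - s * (((v : ℝ) + w) * Real.log ((u : ℝ) + ((v : ℝ) + w) * t)
            - (w : ℝ) * Real.log (((u : ℝ) + v) + (w : ℝ) * t) - (v : ℝ) * Real.log t) := by
  set k : ℝ → ℝ := fun t : ℝ => (((u : ℝ) + v) * Real.log (((u : ℝ) + v) + (w : ℝ) * t)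
        - (u : ℝ) * Real.log ((u : ℝ) + ((v : ℝ) + w) * t))
        - s * (((v : ℝ) + w) * Real.log ((u : ℝ) + ((v : ℝ) + w) * t)
          - (w : ℝ) * Real.log (((u : ℝ) + v) + (w : ℝ) * t) - (v : ℝ) * Real.log t) with hk
  set k' : ℝ → ℝ := fun t : ℝ => (v : ℝ) * ((w : ℝ) * ((v : ℝ) + w) * t - (u : ℝ) * ((u : ℝ) + v)) * (t - s)
        / (t * (((u : ℝ) + v) + (w : ℝ) * t) * ((u : ℝ) + ((v : ℝ) + w) * t)) with hk'
  have hder : ∀ x, 0 < x → HasDerivAt k (k' x) x := fun x hx => hasDerivAt_pocket_k (v := v) (w := w) hu s hx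
  have hcont : ∀ x y, 0 < x → ContinuousOn k (Icc x y) := by
    intro x y hx z hz
    exact (hder z (hx.trans_le hz.1)).continuousAt.continuousWithinAt
  have hv0 : (0 : ℝ) < v := by exact_mod_cast hv
  show min (k p) (k q) ≤ k t
  rcases le_total t s with hts | hst
  · -- `t ≤ s`: `k` is monotone on `[p, t]` (there `k′ ≥ 0`)
    have hmono : MonotoneOn k (Icc p t) := by
      refine monotoneOn_of_hasDerivWithinAt_nonneg (convex_Icc p t) (hcont p t hp)
        (fun x hx => (hder x (hp.trans (interior_Icc (a := p) (b := t) ▸ hx).1)).hasDerivWithinAt) ?_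
      intro x hx
      rw [interior_Icc] at hx
      have hx0 : 0 < x := hp.trans hx.1
      have hwv : (0 : ℝ) ≤ (w : ℝ) * ((v : ℝ) + w) := by positivity
      have hxq : x ≤ q := by linarith [hx.2]
      have hN : (w : ℝ) * ((v : ℝ) + w) * x - (u : ℝ) * ((u : ℝ) + v) ≤ 0 := by
        nlinarith [mul_le_mul_of_nonneg_left hxq hwv]
      have hxs : 0 ≤ s - x := by linarith [hx.2]
      show 0 ≤ k' x
      apply div_nonneg _ (by positivity)
      have h1 : 0 ≤ -((w : ℝ) * ((v : ℝ) + w) * x - (u : ℝ) * ((u : ℝ) + v)) * (s - x) := mul_nonneg (by linarith) hxs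
      nlinarith [mul_nonneg hv0.le h1]
    exact (min_le_left _ _).trans (hmono ⟨le_rfl, hpt⟩ ⟨hpt, le_rfl⟩ hpt)
  · -- `s ≤ t`: `k` is antitone on `[t, q]` (there `k′ ≤ 0`)
    have ht0 : 0 < t := hp.trans_le hpt
    have hanti : AntitoneOn k (Icc t q) := by
      refine antitoneOn_of_hasDerivWithinAt_nonpos (convex_Icc t q) (hcont t q ht0)
        (fun x hx => (hder x (ht0.trans (interior_Icc (a := t) (b := q) ▸ hx).1)).hasDerivWithinAt) ?_
      intro x hx
      rw [interior_Icc] at hx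
      have hx0 : 0 < x := ht0.trans hx.1
      have hwv : (0 : ℝ) ≤ (w : ℝ) * ((v : ℝ) + w) := by positivity
      have hxq : x ≤ q := hx.2.le
      have hN : (w : ℝ) * ((v : ℝ) + w) * x - (u : ℝ) * ((u : ℝ) + v) ≤ 0 := by
        nlinarith [mul_le_mul_of_nonneg_left hxq hwv]
      have hxs : 0 ≤ x - s := by linarith [hx.1]
      show k' x ≤ 0
      apply div_nonpos_of_nonpos_of_nonneg _ (by positivity)
      have h1 : 0 ≤ -((w : ℝ) * ((v : ℝ) + w) * x - (u : ℝ) * ((u : ℝ) + v)) * (x - s) := mul_nonneg (by linarith) hxs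
      nlinarith [mul_nonneg hv0.le h1]
    exact (min_le_right _ _).trans (hanti ⟨le_rfl, htq⟩ ⟨htq, le_rfl⟩ htq)

/-- Derivative of `m = L2 − s·L1` at `t > 0`: `v·(w(v+w)t − u(u+v))·(1 − s·t)/(t·((u+v)+wt)·(u+(v+w)t))`. [folklore] -/
theorem hasDerivAt_pocket_m {u v w : ℕ} (hu : 0 < u) (s : ℝ) {t : ℝ} (ht : 0 < t) :
    HasDerivAt (fun t : ℝ => (((v : ℝ) + w) * Real.log ((u : ℝ) + ((v : ℝ) + w) * t)
          - (w : ℝ) * Real.log (((u : ℝ) + v) + (w : ℝ) * t) - (v : ℝ) * Real.log t)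
        - s * (((u : ℝ) + v) * Real.log (((u : ℝ) + v) + (w : ℝ) * t)
          - (u : ℝ) * Real.log ((u : ℝ) + ((v : ℝ) + w) * t)))
      ((v : ℝ) * ((w : ℝ) * ((v : ℝ) + w) * t - (u : ℝ) * ((u : ℝ) + v)) * (1 - s * t)
        / (t * (((u : ℝ) + v) + (w : ℝ) * t) * ((u : ℝ) + ((v : ℝ) + w) * t))) t := by
  have hA : 0 < ((u : ℝ) + v) + (w : ℝ) * t := by positivity
  have hB : 0 < (u : ℝ) + ((v : ℝ) + w) * t := by positivity
  have hd1 : HasDerivAt (fun t : ℝ => ((u : ℝ) + v) * Real.log (((u : ℝ) + v) + (w : ℝ) * t)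
      - (u : ℝ) * Real.log ((u : ℝ) + ((v : ℝ) + w) * t))
      (((u : ℝ) + v) * ((w : ℝ) / (((u : ℝ) + v) + (w : ℝ) * t))
        - (u : ℝ) * ((((v : ℝ) + w)) / ((u : ℝ) + ((v : ℝ) + w) * t))) t :=
    ((hasDerivAt_log_affine hA).const_mul _).sub ((hasDerivAt_log_affine hB).const_mul _)
  have hd2 : HasDerivAt (fun t : ℝ => ((v : ℝ) + w) * Real.log ((u : ℝ) + ((v : ℝ) + w) * t)
      - (w : ℝ) * Real.log (((u : ℝ) + v) + (w : ℝ) * t) - (v : ℝ) * Real.log t)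
      (((v : ℝ) + w) * ((((v : ℝ) + w)) / ((u : ℝ) + ((v : ℝ) + w) * t))
        - (w : ℝ) * ((w : ℝ) / (((u : ℝ) + v) + (w : ℝ) * t)) - (v : ℝ) * t⁻¹) t :=
    (((hasDerivAt_log_affine hB).const_mul _).sub ((hasDerivAt_log_affine hA).const_mul _)).sub
      ((Real.hasDerivAt_log ht.ne').const_mul _)
  have hd := hd2.sub (hd1.const_mul s)
  refine hd.congr_deriv ?_
  have hA' := hA.ne'; have hB' := hB.ne'; have ht' := ht.ne'
  have e1 : ((u : ℝ) + v) * ((w : ℝ) / (((u : ℝ) + v) + (w : ℝ) * t))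
        - (u : ℝ) * ((((v : ℝ) + w)) / ((u : ℝ) + ((v : ℝ) + w) * t))
      = (v : ℝ) * ((w : ℝ) * ((v : ℝ) + w) * t - (u : ℝ) * ((u : ℝ) + v))
        / ((((u : ℝ) + v) + (w : ℝ) * t) * ((u : ℝ) + ((v : ℝ) + w) * t)) := by
    rw [mul_div_assoc', mul_div_assoc', div_sub_div _ _ hA' hB']
    congr 1; ring
  have e2 : ((v : ℝ) + w) * ((((v : ℝ) + w)) / ((u : ℝ) + ((v : ℝ) + w) * t))
        - (w : ℝ) * ((w : ℝ) / (((u : ℝ) + v) + (w : ℝ) * t)) - (v : ℝ) * t⁻¹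
      = (v : ℝ) * ((w : ℝ) * ((v : ℝ) + w) * t - (u : ℝ) * ((u : ℝ) + v))
        / (t * (((u : ℝ) + v) + (w : ℝ) * t) * ((u : ℝ) + ((v : ℝ) + w) * t)) := by
    field_simp
    ring
  rw [e1, e2, mul_div_assoc', div_sub_div _ _ (by positivity) (by positivity), div_eq_div_iff (by positivity) (by positivity)]
  ring

/-- **`m = L2 − s·L1` is quasi-concave on the upper branch** (`0 ≤ s`): for `t* ≤ p ≤ t ≤ q`, `m(t) ≥ min (m p) (m q)`
(`m′(t) = v·(w(v+w)t − u(u+v))·(1 − s t)/(positive)`, first factor `≥ 0` on the upper branch). [folklore] -/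
theorem pocket_m_upper_ge_min {u v w : ℕ} (hu : 0 < u) (hv : 0 < v) (hw : 0 < w) {s p q t : ℝ} (hs : 0 ≤ s)
    (hp : (u : ℝ) * ((u : ℝ) + v) ≤ (w : ℝ) * ((v : ℝ) + w) * p) (hpt : p ≤ t) (htq : t ≤ q) :
    min ((((v : ℝ) + w) * Real.log ((u : ℝ) + ((v : ℝ) + w) * p)
          - (w : ℝ) * Real.log (((u : ℝ) + v) + (w : ℝ) * p) - (v : ℝ) * Real.log p)
          - s * (((u : ℝ) + v) * Real.log (((u : ℝ) + v) + (w : ℝ) * p) - (u : ℝ) * Real.log ((u : ℝ) + ((v : ℝ) + w) * p)))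
        ((((v : ℝ) + w) * Real.log ((u : ℝ) + ((v : ℝ) + w) * q)
          - (w : ℝ) * Real.log (((u : ℝ) + v) + (w : ℝ) * q) - (v : ℝ) * Real.log q)
          - s * (((u : ℝ) + v) * Real.log (((u : ℝ) + v) + (w : ℝ) * q) - (u : ℝ) * Real.log ((u : ℝ) + ((v : ℝ) + w) * q)))
      ≤ (((v : ℝ) + w) * Real.log ((u : ℝ) + ((v : ℝ) + w) * t)
          - (w : ℝ) * Real.log (((u : ℝ) + v) + (w : ℝ) * t) - (v : ℝ) * Real.log t)
          - s * (((u : ℝ) + v) * Real.log (((u : ℝ) + v) + (w : ℝ) * t) - (u : ℝ) * Real.log ((u : ℝ) + ((v : ℝ) + w) * t)) := by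
  set m : ℝ → ℝ := fun t : ℝ => (((v : ℝ) + w) * Real.log ((u : ℝ) + ((v : ℝ) + w) * t)
        - (w : ℝ) * Real.log (((u : ℝ) + v) + (w : ℝ) * t) - (v : ℝ) * Real.log t)
        - s * (((u : ℝ) + v) * Real.log (((u : ℝ) + v) + (w : ℝ) * t)
          - (u : ℝ) * Real.log ((u : ℝ) + ((v : ℝ) + w) * t)) with hm
  set m' : ℝ → ℝ := fun t : ℝ => (v : ℝ) * ((w : ℝ) * ((v : ℝ) + w) * t - (u : ℝ) * ((u : ℝ) + v)) * (1 - s * t)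
        / (t * (((u : ℝ) + v) + (w : ℝ) * t) * ((u : ℝ) + ((v : ℝ) + w) * t)) with hm'
  have hT0 : 0 < (u : ℝ) * ((u : ℝ) + v) := by positivity
  have hwv : (0 : ℝ) < (w : ℝ) * ((v : ℝ) + w) := by positivity
  have hp0 : 0 < p := by
    by_contra h; push Not at h; nlinarith [mul_le_mul_of_nonneg_left h hwv.le]
  have hder : ∀ x, 0 < x → HasDerivAt m (m' x) x := fun x hx => hasDerivAt_pocket_m (v := v) (w := w) hu s hx
  have hcont : ∀ x y, 0 < x → ContinuousOn m (Icc x y) := by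
    intro x y hx z hz
    exact (hder z (hx.trans_le hz.1)).continuousAt.continuousWithinAt
  have hv0 : (0 : ℝ) < v := by exact_mod_cast hv
  show min (m p) (m q) ≤ m t
  rcases le_total (s * t) 1 with hts | hst
  · -- `s t ≤ 1`: `m` is monotone on `[p, t]`
    have hmono : MonotoneOn m (Icc p t) := by
      refine monotoneOn_of_hasDerivWithinAt_nonneg (convex_Icc p t) (hcont p t hp0)
        (fun x hx => (hder x (hp0.trans (interior_Icc (a := p) (b := t) ▸ hx).1)).hasDerivWithinAt) ?_
      intro x hx
      rw [interior_Icc] at hx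
      have hx0 : 0 < x := hp0.trans hx.1
      have hN : 0 ≤ (w : ℝ) * ((v : ℝ) + w) * x - (u : ℝ) * ((u : ℝ) + v) := by
        nlinarith [mul_le_mul_of_nonneg_left hx.1.le hwv.le]
      have hxs : 0 ≤ 1 - s * x := by nlinarith [mul_le_mul_of_nonneg_left hx.2.le hs]
      show 0 ≤ m' x
      exact div_nonneg (mul_nonneg (mul_nonneg hv0.le hN) hxs) (by positivity)
    exact (min_le_left _ _).trans (hmono ⟨le_rfl, hpt⟩ ⟨hpt, le_rfl⟩ hpt)
  · -- `1 ≤ s t`: `m` is antitone on `[t, q]`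
    have ht0 : 0 < t := hp0.trans_le hpt
    have hanti : AntitoneOn m (Icc t q) := by
      refine antitoneOn_of_hasDerivWithinAt_nonpos (convex_Icc t q) (hcont t q ht0)
        (fun x hx => (hder x (ht0.trans (interior_Icc (a := t) (b := q) ▸ hx).1)).hasDerivWithinAt) ?_
      intro x hx
      rw [interior_Icc] at hx
      have hx0 : 0 < x := ht0.trans hx.1
      have hN : 0 ≤ (w : ℝ) * ((v : ℝ) + w) * x - (u : ℝ) * ((u : ℝ) + v) := by
        nlinarith [mul_le_mul_of_nonneg_left (hpt.trans hx.1.le) hwv.le]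
      have hxs : 1 - s * x ≤ 0 := by nlinarith [mul_le_mul_of_nonneg_left hx.1.le hs]
      show m' x ≤ 0
      exact div_nonpos_of_nonpos_of_nonneg (mul_nonpos_of_nonneg_of_nonpos (mul_nonneg hv0.le hN) hxs) (by positivity)
    exact (min_le_right _ _).trans (hanti ⟨le_rfl, htq⟩ ⟨htq, le_rfl⟩ htq)

/-! ## Product facts about the branch constants ⇒ log facts (`L1 = log H1`, `L2 = log H2` expanded) -/

/-- `log (x^i · y^j · z^k) = i log x + j log y + k log z` for positive reals. [folklore] -/
theorem log_pow_mul_pow_mul_pow {x y z : ℝ} (hx : 0 < x) (hy : 0 < y) (hz : 0 < z) (i j k : ℕ) :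
    Real.log (x ^ i * y ^ j * z ^ k) = (i : ℝ) * Real.log x + (j : ℝ) * Real.log y + (k : ℝ) * Real.log z := by
  rw [Real.log_mul (by positivity) (by positivity), Real.log_mul (by positivity) (by positivity),
    Real.log_pow, Real.log_pow, Real.log_pow]

/-- `H1(t) ≤ M` as a product fact ⇒ `L1(t) − v log v ≤ log M`. [folklore] -/
theorem pocket_logH1_le_of_prod {u v w : ℕ} (hu : 0 < u) (hv : 0 < v) {t M : ℝ} (ht : 0 < t) (hM : 0 < M)
    (h : (((u : ℝ) + v) + (w : ℝ) * t) ^ (u + v) ≤ M * ((v : ℝ) ^ v * ((u : ℝ) + ((v : ℝ) + w) * t) ^ u)) :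
    (((u : ℝ) + v) * Real.log (((u : ℝ) + v) + (w : ℝ) * t) - (u : ℝ) * Real.log ((u : ℝ) + ((v : ℝ) + w) * t)) - (v : ℝ) * Real.log (v : ℝ) ≤ Real.log M := by
  have hv0 : (0 : ℝ) < v := by exact_mod_cast hv
  have hA : 0 < (((u : ℝ) + v) + (w : ℝ) * t) := by positivity
  have hB : 0 < ((u : ℝ) + ((v : ℝ) + w) * t) := by positivity
  have hl := (Real.log_le_log_iff (by positivity) (by positivity)).mpr h
  rw [Real.log_pow, Real.log_mul (by positivity) (by positivity), Real.log_mul (by positivity) (by positivity),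
    Real.log_pow, Real.log_pow] at hl
  push_cast at hl; linarith

/-- `F ≤ H1(t)` as a product fact ⇒ `log F ≤ L1(t) − v log v`. [folklore] -/
theorem pocket_le_logH1_of_prod {u v w : ℕ} (hu : 0 < u) (hv : 0 < v) {t F : ℝ} (ht : 0 < t) (hF : 0 < F)
    (h : F * ((v : ℝ) ^ v * ((u : ℝ) + ((v : ℝ) + w) * t) ^ u) ≤ (((u : ℝ) + v) + (w : ℝ) * t) ^ (u + v)) :
    Real.log F ≤ (((u : ℝ) + v) * Real.log (((u : ℝ) + v) + (w : ℝ) * t) - (u : ℝ) * Real.log ((u : ℝ) + ((v : ℝ) + w) * t)) - (v : ℝ) * Real.log (v : ℝ) := by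
  have hv0 : (0 : ℝ) < v := by exact_mod_cast hv
  have hA : 0 < (((u : ℝ) + v) + (w : ℝ) * t) := by positivity
  have hB : 0 < ((u : ℝ) + ((v : ℝ) + w) * t) := by positivity
  have hl := (Real.log_le_log_iff (by positivity) (by positivity)).mpr h
  rw [Real.log_pow, Real.log_mul (by positivity) (by positivity), Real.log_mul (by positivity) (by positivity),
    Real.log_pow, Real.log_pow] at hl
  push_cast at hl; linarith

/-- `H2(t) ≤ M` as a product fact ⇒ `L2(t) − v log v ≤ log M`. [folklore] -/
theorem pocket_logH2_le_of_prod {u v w : ℕ} (hu : 0 < u) (hv : 0 < v) {t M : ℝ} (ht : 0 < t) (hM : 0 < M)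
    (h : ((u : ℝ) + ((v : ℝ) + w) * t) ^ (v + w) ≤ M * ((v : ℝ) ^ v * ((((u : ℝ) + v) + (w : ℝ) * t) ^ w * t ^ v))) :
    (((v : ℝ) + w) * Real.log ((u : ℝ) + ((v : ℝ) + w) * t) - (w : ℝ) * Real.log (((u : ℝ) + v) + (w : ℝ) * t) - (v : ℝ) * Real.log t) - (v : ℝ) * Real.log (v : ℝ) ≤ Real.log M := by
  have hv0 : (0 : ℝ) < v := by exact_mod_cast hv
  have hA : 0 < (((u : ℝ) + v) + (w : ℝ) * t) := by positivity
  have hB : 0 < ((u : ℝ) + ((v : ℝ) + w) * t) := by positivity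
  have hl := (Real.log_le_log_iff (by positivity) (by positivity)).mpr h
  rw [Real.log_pow, Real.log_mul (by positivity) (by positivity), Real.log_mul (by positivity) (by positivity),
    Real.log_mul (by positivity) (by positivity), Real.log_pow, Real.log_pow, Real.log_pow] at hl
  push_cast at hl; linarith

/-- `F ≤ H2(t)` as a product fact ⇒ `log F ≤ L2(t) − v log v`. [folklore] -/
theorem pocket_le_logH2_of_prod {u v w : ℕ} (hu : 0 < u) (hv : 0 < v) {t F : ℝ} (ht : 0 < t) (hF : 0 < F)
    (h : F * ((v : ℝ) ^ v * ((((u : ℝ) + v) + (w : ℝ) * t) ^ w * t ^ v)) ≤ ((u : ℝ) + ((v : ℝ) + w) * t) ^ (v + w)) :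
    Real.log F ≤ (((v : ℝ) + w) * Real.log ((u : ℝ) + ((v : ℝ) + w) * t) - (w : ℝ) * Real.log (((u : ℝ) + v) + (w : ℝ) * t) - (v : ℝ) * Real.log t) - (v : ℝ) * Real.log (v : ℝ) := by
  have hv0 : (0 : ℝ) < v := by exact_mod_cast hv
  have hA : 0 < (((u : ℝ) + v) + (w : ℝ) * t) := by positivity
  have hB : 0 < ((u : ℝ) + ((v : ℝ) + w) * t) := by positivity
  have hl := (Real.log_le_log_iff (by positivity) (by positivity)).mpr h
  rw [Real.log_pow, Real.log_mul (by positivity) (by positivity), Real.log_mul (by positivity) (by positivity),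
    Real.log_mul (by positivity) (by positivity), Real.log_pow, Real.log_pow, Real.log_pow] at hl
  push_cast at hl; linarith

end Summit.ValiantsHypothesis.ValiantsHypothesis.Theorems.LacunarySymmetroidMatrixDescartes.Census
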